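import Summits.MatrixMultiplication.MatrixMultiplication.Theses.CondensationDistance

/-!
# Crux attack on `DerivationsBoundOmega` (stmt-MatrixMultiplication-15940) — refuter probes, cycle 1

Route `route-MatrixMultiplication-CondensationDistance`, crux rank 6 (literature bridge "ω ≤ ω(Det)",
BCS 1997 Thm. (16.7)). Sorry-free findings of the basic attacks (refuter-rattack-…-15940-0, 2026-08-17):

* `body_iff` — the decl is definitionally its displayed body (elaboration read-back; no hidden coercion
  beyond `ℕ → ℝ` casts and `Real.rpow`).
* `summit_implies_crux_body` — **S → C**: `MatrixMultiplication → DerivationsBoundOmega` trivially (conclusion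
  `omega ℂ ≤ τ`, `τ ≥ 2`); hence `not_crux_implies_not_summit` — a refutation of this crux would be a proof of
  `ω(ℂ) ≠ 2`: the item is irrefutable short of disproving the summit. (C → S fails: `exact?`/`aesop`, Scratch T2.)
* `crux_slice_ge_three` — the slice `τ ≥ 3` holds with the hypothesis UNUSED (`omega_le_three'`); the content
  of the item is `τ ∈ [2, 3)`.
* `witness_one`, `witness_two` — the hypothesis PREDICATE as typed (instances `Algebra ℂ (FractionRing ℂ[Z])`,
  `Fin.castLE`, `Matrix.of`) is inhabitable: `det X₁` in 0 steps, `det X₂` in 3 steps. (The asymptotic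
  hypothesis holds on paper for every `τ > ω(Det) = ω`, e.g. `τ = 3` by division Gaussian elimination over
  `ℂ(Z)`; not in tree.)

Verdict: survives — true as typed (known mathematics; the registered line `Lines/birth.lean` reduces it to
three in-tree theorems). No Disproof.lean exists for this crux; nothing cited from it.
-/

-- the tree's namespace `Summit.MatrixMultiplication.MatrixMultiplication.…` repeats a component by design
set_option linter.dupNamespace false

noncomputable section

namespace Summit.MatrixMultiplication.MatrixMultiplication.Cruxes.DerivationsBoundOmega.Attack

open Literature.Computability.AlgebraicComplexity
open Summit.MatrixMultiplication.MatrixMultiplication.Theses.CondensationDistance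

/-- Read-back: the decl is definitionally the displayed body. -/
theorem body_iff : DerivationsBoundOmega ↔ (∀ τ : ℝ, 2 ≤ τ → (∃ C : ℝ, ∃ n₀ : ℕ, ∀ n ≥ n₀, ∃ (m' : ℕ) (h : n ≤ m') (s : ℕ), (s : ℝ) ≤ C * (n : ℝ) ^ τ ∧ Literature.Computability.AlgebraicComplexity.Derivable ℂ s (Set.range fun p : Fin n × Fin m' => algebraMap (MvPolynomial (Fin n × Fin m') ℂ) (FractionRing (MvPolynomial (Fin n × Fin m') ℂ)) (MvPolynomial.X p)) {algebraMap (MvPolynomial (Fin n × Fin m') ℂ) (FractionRing (MvPolynomial (Fin n × Fin m') ℂ)) (Matrix.det (Matrix.of fun i j : Fin n => MvPolynomial.X (i, Fin.castLE h j)))}) → Literature.Computability.AlgebraicComplexity.omega ℂ ≤ τ) :=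
  Iff.rfl

/-- **S → C**: `ω(ℂ) = 2` implies the crux (as it does every `… → omega ℂ ≤ τ` bridge with `τ ≥ 2`).
Conclusion = the crux BODY verbatim (not the name), so that no audit mistakes this for a proof of the item. -/
theorem summit_implies_crux_body (hω : omega ℂ = 2) : ∀ τ : ℝ, 2 ≤ τ → (∃ C : ℝ, ∃ n₀ : ℕ, ∀ n ≥ n₀, ∃ (m' : ℕ) (h : n ≤ m') (s : ℕ), (s : ℝ) ≤ C * (n : ℝ) ^ τ ∧ Literature.Computability.AlgebraicComplexity.Derivable ℂ s (Set.range fun p : Fin n × Fin m' => algebraMap (MvPolynomial (Fin n × Fin m') ℂ) (FractionRing (MvPolynomial (Fin n × Fin m') ℂ)) (MvPolynomial.X p)) {algebraMap (MvPolynomial (Fin n × Fin m') ℂ) (FractionRing (MvPolynomial (Fin n × Fin m') ℂ)) (Matrix.det (Matrix.of fun i j : Fin n => MvPolynomial.X (i, Fin.castLE h j)))}) → Literature.Computability.AlgebraicComplexity.omega ℂ ≤ τ := by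
  intro τ hτ _
  rw [hω]; exact hτ

/-- Hence `¬ C → ¬ S`: refuting the crux means proving `ω(ℂ) ≠ 2`. -/
theorem not_crux_implies_not_summit : ¬ DerivationsBoundOmega → ¬ _root_.MatrixMultiplication :=
  fun h hS => h (summit_implies_crux_body (MatrixMultiplication_iff.mp hS))

/-- The slice `τ ≥ 3` of the crux is a theorem now, hypothesis unused (`ω(ℂ) ≤ 3`). -/
theorem crux_slice_ge_three : ∀ τ : ℝ, 3 ≤ τ → (∃ C : ℝ, ∃ n₀ : ℕ, ∀ n ≥ n₀, ∃ (m' : ℕ) (h : n ≤ m') (s : ℕ), (s : ℝ) ≤ C * (n : ℝ) ^ τ ∧ Literature.Computability.AlgebraicComplexity.Derivable ℂ s (Set.range fun p : Fin n × Fin m' => algebraMap (MvPolynomial (Fin n × Fin m') ℂ) (FractionRing (MvPolynomial (Fin n × Fin m') ℂ)) (MvPolynomial.X p)) {algebraMap (MvPolynomial (Fin n × Fin m') ℂ) (FractionRing (MvPolynomial (Fin n × Fin m') ℂ)) (Matrix.det (Matrix.of fun i j : Fin n => MvPolynomial.X (i, Fin.castLE h j)))}) → Literature.Computability.AlgebraicComplexity.omega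 ℂ ≤ τ := by
  intro τ hτ _
  exact (omega_le_three' ℂ).trans hτ

/-- n = 1: `det X = X₀₀` is an input, derivable in 0 steps. -/
theorem witness_one (m' : ℕ) (h : 1 ≤ m') :
    Derivable ℂ 0
      (Set.range fun p : Fin 1 × Fin m' =>
        algebraMap (MvPolynomial (Fin 1 × Fin m') ℂ) (FractionRing (MvPolynomial (Fin 1 × Fin m') ℂ))
          (MvPolynomial.X p))
      {algebraMap (MvPolynomial (Fin 1 × Fin m') ℂ) (FractionRing (MvPolynomial (Fin 1 × Fin m') ℂ))
        (Matrix.det (Matrix.of fun i j : Fin 1 => MvPolynomial.X (i, Fin.castLE h j)))} := by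
  refine Derivable.of_subset ?_ 0
  intro x hx
  rw [Set.mem_singleton_iff] at hx
  subst hx
  left
  refine ⟨((0 : Fin 1), Fin.castLE h 0), ?_⟩
  simp [Matrix.det_unique]

/-- n = 2: `det X = X₀₀ X₁₁ − X₀₁ X₁₀`, derivable in 3 steps (two products, one linear combination). -/
theorem witness_two (m' : ℕ) (h : 2 ≤ m') :
    Derivable ℂ 3
      (Set.range fun p : Fin 2 × Fin m' =>
        algebraMap (MvPolynomial (Fin 2 × Fin m') ℂ) (FractionRing (MvPolynomial (Fin 2 × Fin m') ℂ))
          (MvPolynomial.X p))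
      {algebraMap (MvPolynomial (Fin 2 × Fin m') ℂ) (FractionRing (MvPolynomial (Fin 2 × Fin m') ℂ))
        (Matrix.det (Matrix.of fun i j : Fin 2 => MvPolynomial.X (i, Fin.castLE h j)))} := by
  set K := FractionRing (MvPolynomial (Fin 2 × Fin m') ℂ)
  set ι := algebraMap (MvPolynomial (Fin 2 × Fin m') ℂ) K with hι
  set A : Set K := Set.range fun p : Fin 2 × Fin m' => ι (MvPolynomial.X p) with hA
  have mem : ∀ (i : Fin 2) (j : Fin 2), ι (MvPolynomial.X (i, Fin.castLE h j)) ∈ A :=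
    fun i j => ⟨(i, Fin.castLE h j), rfl⟩
  set a := ι (MvPolynomial.X ((0 : Fin 2), Fin.castLE h 0))
  set b := ι (MvPolynomial.X ((0 : Fin 2), Fin.castLE h 1))
  set c := ι (MvPolynomial.X ((1 : Fin 2), Fin.castLE h 0))
  set d := ι (MvPolynomial.X ((1 : Fin 2), Fin.castLE h 1))
  -- step 1: a*d ; step 2: b*c ; step 3: 1•(a*d) + (-1)•(b*c)
  have h1 : Derivable ℂ 1 A {a * d} := Derivable.mul (Or.inl (mem 0 0)) (Or.inl (mem 1 1))
  have h2 : Derivable ℂ 1 (A ∪ {a * d}) {b * c} :=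
    Derivable.mul (Or.inl (Or.inl (mem 0 1))) (Or.inl (Or.inl (mem 1 0)))
  have h3 : Derivable ℂ 1 ((A ∪ {a * d}) ∪ {b * c}) {(1 : ℂ) • (a * d) + (-1 : ℂ) • (b * c)} :=
    Derivable.lin (k := ℂ) (A := (A ∪ {a * d}) ∪ {b * c}) (x := a * d) (y := b * c)
      (Or.inl (Or.inl (Or.inr rfl))) (Or.inl (Or.inr rfl)) 1 (-1)
  have h23 : Derivable ℂ 2 (A ∪ {a * d}) {(1 : ℂ) • (a * d) + (-1 : ℂ) • (b * c)} :=
    Derivable.trans h2 h3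
  have h123 : Derivable ℂ 3 A {(1 : ℂ) • (a * d) + (-1 : ℂ) • (b * c)} := Derivable.trans h1 h23
  refine h123.mono le_rfl subset_rfl ?_
  intro x hx
  rw [Set.mem_singleton_iff] at hx ⊢
  subst hx
  rw [Matrix.det_fin_two]
  simp only [Matrix.of_apply, map_sub, map_mul, one_smul, neg_one_smul]
  simp only [a, b, c, d]
  ring_nf
  rfl

end Summit.MatrixMultiplication.MatrixMultiplication.Cruxes.DerivationsBoundOmega.Attack

end
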